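import Summits.QuantumFields.YangMills.Theorems.VirialFluxGapConjSliceFirstVariation
import HarnessLib

/-!
# The normal slice of the diagonal conjugation action of `SU(2)` on `SU(2)^I` is HIT: covering ∕ local surjectivity
# by minimising the squared geodesic distance over the compact group
# (layer (B2), input «tubes cover a neighbourhood of the orbit», of the DIRECT Laplace road to ⟨stmt-QuantumFields-24204⟩
# `VirialFluxGap.SharpTwistedLaplace`)

Helper module (free-hands work of width seat ym-line-sfw-p2-w2 g50, cell ym-idea-1; `--supports 24204`).  Sequel of
✓`VirialFluxGapConjSliceFirstVariation` (the one-variable calculus).  On the tree-gauged ring space `X_fix ≅ SU(2)^I`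
(✓`VirialFluxGapFixGaugeAction`) the residual symmetry is the CONSTANT `SU(2)` acting by simultaneous conjugation
`k · (u_i)_i = (k u_i k⁻¹)_i`.  At a base point `Q = (q_i)_i` we use the LEFT exponential chart `u_i = exp(y_i)·q_i`, `y_i ∈ Im ℍ ≅ ℝ³`
(the chart of ✓`exists_skew_linearised_le_sqrt_ringDeficit`, `P = e^{A}·R`); the orbit tangent is `η ↦ ((1 − Ad_{q_i}) η)_i` and the
NORMAL (linear) SLICE is its orthogonal complement `V = {y | Σ_i (y_i − q_i⁻¹ y_i q_i) = 0}` (`q⁻¹ y q = star(q) y q`, `Ad_{q}ᵀ = Ad_{q⁻¹}`).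

THE STATEMENT (★★ `exists_conj_exp_slice`).  For every finite family `u : I → SU(2)` within `ℓ²`-GEODESIC distance `π` of `Q`
(`Σ_i arccos(Re(u_i q̄_i))² < π²`) there are a constant `k ∈ SU(2)` and imaginary quaternions `y_i` with
  `k u_i k⁻¹ = exp(y_i) · q_i`,  `‖y_i‖ = arccos Re(k u_i k⁻¹ q̄_i)`,  `Σ_i ‖y_i‖² ≤ Σ_i arccos(Re(u_i q̄_i))²`  and
  `Σ_i (y_i − q̄_i y_i q_i) = 0`  (the slice equation, EXACTLY).
So every point of `X_fix` near the orbit `K·Q` lies in the tube `K·σ(B̄_R)` of the linear slice with the SAME radius — the input that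
turns ✓`ringDeficit_fix_floor` into the hypothesis `hfloor` of ✓`sharpTwistedLaplace_of_fixTubes`, with no inverse function theorem
and no loss in the radius.

THE PROOF.  Minimise `Φ(k) = Σ_i arccos(Re(k u_i k⁻¹ q̄_i))²` (sum of squared geodesic distances on `S³`) over the compact group
(`IsCompact.exists_isMinOn`).  At a minimiser, re-centred to `k = 1`, differentiate along the hemisphere curves
`c(t) = √(1 − t²‖η‖²) + tη` (`η` imaginary; ✓`hasDerivAt_arccos_sq_conj`): the first variation is `2⟪Σ_i (y_i − q̄_i y_i q_i), η⟫`,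
LINEAR in the log-coordinates, and Fermat (`IsLocalMin.hasDerivAt_eq_zero`) with `η = Σ_i (y_i − q̄_i y_i q_i)` gives the slice
equation (`sum_logSlice_eq_zero_of_isMinOn`); §5 packages the closed-form logarithm (`norm_logQuat`, `exp_logQuat`).
Everything here is PROVED; no definitions, no named facts (namespace `Summit.QuantumFields.YangMills.Theorems.QuantitativeLaplace`).

HONEST FRAMING: finite-dimensional calculus on `S³`; ⟨24204⟩, ⟨24319⟩, ⟨22884⟩ and every rung stay OPEN; the Yang–Mills mass gap (Clay)
is NOT touched; no summit is proved by a line.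

## References
* G. E. Bredon, *Introduction to Compact Transformation Groups* (1972), Ch. II §§4–5 (slices, tubes). [Bredon1972]
* H. Karcher, Comm. Pure Appl. Math. 30 (1977) 509–541, §1 (first variation of the squared Riemannian distance). [folklore here]
* S. Helgason, *Groups and Geometric Analysis* (2000), Ch. I §1 Thm 1.14. [Helgason2000]
-/

set_option autoImplicit false

noncomputable section

open scoped Quaternion RealInnerProductSpace Topology BigOperators
open NormedSpace Filter Asymptotics Set
open Literature.MathematicalPhysics.QuantumFieldTheory hiding SU2 su2Quat_mul
open Literature.MathematicalPhysics.QuantumLattice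
open Literature.MathematicalPhysics.QuantumFieldTheory.Balaban1983to89.T4HaarSU2Translate (su2Quat_mul su2Quat_quatToSU2
  continuous_su2Quat)
open Literature.MathematicalPhysics.QuantumFieldTheory.Balaban1983to89.T4WilsonLinkAffine (su2Quat_inv)
open Summit.QuantumFields.YangMills.Theorems.FemtoTransferGap
open Summit.QuantumFields.YangMills.Theorems.ToronValleyVolume.Lojasiewicz (norm_sq_eq_re_sq_add_imDot)
open Summit.QuantumFields.YangMills.BalabanUVNodes.N08HaarCompatibilityGuardGeodesics (re_mul_mul_star)
open Summit.QuantumFields.YangMills.Theorems.VirialFluxGap.AnchorSlice (re_conj_unit)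

namespace Summit.QuantumFields.YangMills.Theorems.QuantitativeLaplace

/-! ## §4 Fermat: at a conjugation-minimiser the log-coordinates lie in the normal slice -/

/-- ★★ **The slice equation at a minimiser.**  If the identity minimises `k ↦ Σ_i arccos(Re(k v_i k⁻¹ q̄_i))²` over `SU(2)` and no
`v_i q̄_i` is the antipode `−1`, then with `w_i = v_i q̄_i`, `y_i = (arccos Re w_i ∕ √(1 − (Re w_i)²))·Im w_i = Log w_i`:
`Σ_i (y_i − q̄_i y_i q_i) = 0`. [folklore] -/
theorem sum_logSlice_eq_zero_of_isMinOn {ι : Type*} [Fintype ι] {q v : ι → SU2}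
    (hne : ∀ i, (su2Quat (v i * (q i)⁻¹)).re ≠ -1)
    (hmin : ∀ k : SU2, ∑ i, Real.arccos ((su2Quat (v i * (q i)⁻¹)).re) ^ 2 ≤
      ∑ i, Real.arccos ((su2Quat (k * v i * k⁻¹ * (q i)⁻¹)).re) ^ 2) :
    ∑ i, (Real.arccos ((su2Quat (v i * (q i)⁻¹)).re) / Real.sqrt (1 - (su2Quat (v i * (q i)⁻¹)).re ^ 2)) •
        ((su2Quat (v i * (q i)⁻¹)).im - star (su2Quat (q i)) * (su2Quat (v i * (q i)⁻¹)).im * su2Quat (q i)) = 0 := by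
  set S : ℍ := ∑ i, (Real.arccos ((su2Quat (v i * (q i)⁻¹)).re) / Real.sqrt (1 - (su2Quat (v i * (q i)⁻¹)).re ^ 2)) •
        ((su2Quat (v i * (q i)⁻¹)).im - star (su2Quat (q i)) * (su2Quat (v i * (q i)⁻¹)).im * su2Quat (q i)) with hS
  have hvq : ∀ i, su2Quat (v i * (q i)⁻¹) = su2Quat (v i) * star (su2Quat (q i)) := fun i => by
    rw [su2Quat_mul, su2Quat_inv]
  -- `S` is imaginary
  have hSre : S.re = 0 := by
    rw [hS, quat_re_eq_inner_one, sum_inner]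
    refine Finset.sum_eq_zero fun i _ => ?_
    have h := re_mul_mul_star (star (su2Quat (q i))) (x := (su2Quat (v i * (q i)⁻¹)).im) (by simp)
    rw [star_star] at h
    rw [← quat_re_eq_inner_one]
    simp [h]
  -- the variation along the hemisphere curve of `S`
  set f : ℝ → ℝ := fun t => ∑ i, Real.arccos (((Real.sqrt (1 - t ^ 2 * ‖S‖ ^ 2) • (1 : ℍ) + t • S) * su2Quat (v i) *
      (Real.sqrt (1 - t ^ 2 * ‖S‖ ^ 2) • (1 : ℍ) - t • S) * star (su2Quat (q i))).re) ^ 2 with hf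
  have hderiv : HasDerivAt f (∑ i, 2 * ⟪(Real.arccos (su2Quat (v i) * star (su2Quat (q i))).re /
      Real.sqrt (1 - (su2Quat (v i) * star (su2Quat (q i))).re ^ 2)) • ((su2Quat (v i) * star (su2Quat (q i))).im -
        star (su2Quat (q i)) * (su2Quat (v i) * star (su2Quat (q i))).im * star (star (su2Quat (q i)))), S⟫) 0 := by
    rw [hf]
    exact HasDerivAt.fun_sum fun i _ => hasDerivAt_arccos_sq_conj (norm_su2Quat (v i))
      (by rw [norm_star]; exact norm_su2Quat (q i)) hSre (by rw [← hvq]; exact hne i)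
  have hval : (∑ i, 2 * ⟪(Real.arccos (su2Quat (v i) * star (su2Quat (q i))).re /
      Real.sqrt (1 - (su2Quat (v i) * star (su2Quat (q i))).re ^ 2)) • ((su2Quat (v i) * star (su2Quat (q i))).im -
        star (su2Quat (q i)) * (su2Quat (v i) * star (su2Quat (q i))).im * star (star (su2Quat (q i)))), S⟫) = 2 * ⟪S, S⟫ := by
    rw [← Finset.mul_sum, ← sum_inner, hS]
    simp only [star_star, hvq]
  rw [hval] at hderiv
  -- `0` is a local minimum of `f`
  have hloc : IsLocalMin f 0 := by
    show ∀ᶠ t in 𝓝 (0 : ℝ), f 0 ≤ f t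
    filter_upwards [eventually_sq_mul_norm_sq_le_one S] with t ht
    have hunit := norm_hemisphere hSre ht
    have hk : su2Quat (quatToSU2 (Real.sqrt (1 - t ^ 2 * ‖S‖ ^ 2) • (1 : ℍ) + t • S)) =
        Real.sqrt (1 - t ^ 2 * ‖S‖ ^ 2) • (1 : ℍ) + t • S := by
      rw [su2Quat_quatToSU2 (by intro h; rw [h, norm_zero] at hunit; exact zero_ne_one hunit), hunit, inv_one, one_smul]
    have hk' : su2Quat (quatToSU2 (Real.sqrt (1 - t ^ 2 * ‖S‖ ^ 2) • (1 : ℍ) + t • S))⁻¹ =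
        Real.sqrt (1 - t ^ 2 * ‖S‖ ^ 2) • (1 : ℍ) - t • S := by
      rw [su2Quat_inv, hk, star_hemisphere hSre]
    have h0 : f 0 = ∑ i, Real.arccos ((su2Quat (v i * (q i)⁻¹)).re) ^ 2 := by
      simp [hf, hvq]
    have ht' : f t = ∑ i, Real.arccos ((su2Quat (quatToSU2 (Real.sqrt (1 - t ^ 2 * ‖S‖ ^ 2) • (1 : ℍ) + t • S) * v i *
        (quatToSU2 (Real.sqrt (1 - t ^ 2 * ‖S‖ ^ 2) • (1 : ℍ) + t • S))⁻¹ * (q i)⁻¹)).re) ^ 2 := by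
      simp only [hf, su2Quat_mul, hk', hk, su2Quat_inv]
    rw [h0, ht']
    exact hmin _
  have hzero := hloc.hasDerivAt_eq_zero hderiv
  have : ⟪S, S⟫ = 0 := by linarith
  exact inner_self_eq_zero.mp this


/-! ## §5 The logarithm in closed form, a minimiser over the compact group, and the covering theorem -/

/-- The closed-form logarithm `Log w = (arccos Re w ∕ √(1 − (Re w)²))·Im w` of a unit quaternion `w ≠ −1` has norm
`arccos Re w` (the geodesic distance from `1`). [folklore] -/
theorem norm_logQuat {w : ℍ} (hw : ‖w‖ = 1) (hne : w.re ≠ -1) :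
    ‖(Real.arccos w.re / Real.sqrt (1 - w.re ^ 2)) • w.im‖ = Real.arccos w.re := by
  have him : ‖w.im‖ = Real.sqrt (1 - w.re ^ 2) := quat_norm_im_eq_sqrt hw
  have h0 : 0 ≤ Real.arccos w.re := Real.arccos_nonneg _
  by_cases h1 : w.re = 1
  · rw [h1, Real.arccos_one, zero_div, zero_smul, norm_zero]
  · have hlt : w.re ^ 2 < 1 := by
      have hle := quat_abs_re_le_one hw
      have : |w.re| < 1 := lt_of_le_of_ne hle (by
        intro h; rcases abs_eq (zero_le_one) |>.mp h with h' | h' <;> [exact h1 h'; exact hne h'])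
      have := abs_lt.mp this
      nlinarith
    have hs : 0 < Real.sqrt (1 - w.re ^ 2) := Real.sqrt_pos.mpr (by linarith)
    rw [norm_smul, him, Real.norm_eq_abs, abs_div, abs_of_nonneg h0, abs_of_pos hs, div_mul_cancel₀ _ hs.ne']

/-- The closed-form logarithm exponentiates back: `exp((arccos Re w ∕ √(1 − (Re w)²))·Im w) = w` for a unit `w ≠ −1`.
[folklore] -/
theorem exp_logQuat {w : ℍ} (hw : ‖w‖ = 1) (hne : w.re ≠ -1) :
    exp ((Real.arccos w.re / Real.sqrt (1 - w.re ^ 2)) • w.im) = w := by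
  have hle := abs_le.mp (quat_abs_re_le_one hw)
  rw [Quaternion.exp_of_re_eq_zero _ (by simp), norm_logQuat hw hne, Real.cos_arccos hle.1 hle.2, smul_smul]
  by_cases h1 : w.re = 1
  · have hw1 : w = 1 := quat_eq_one_of_norm_one_of_re hw h1
    rw [hw1]; simp
  · have hlt1 : w.re < 1 := lt_of_le_of_ne hle.2 h1
    have hlt2 : -1 < w.re := lt_of_le_of_ne hle.1 (Ne.symm hne)
    have hlt : w.re ^ 2 < 1 := by nlinarith
    have hs : 0 < Real.sqrt (1 - w.re ^ 2) := Real.sqrt_pos.mpr (by linarith)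
    have hθ : Real.arccos w.re ≠ 0 := by
      intro h; rw [Real.arccos_eq_zero] at h; exact h1 (le_antisymm hle.2 h)
    have hcoef : Real.sin (Real.arccos w.re) / Real.arccos w.re * (Real.arccos w.re / Real.sqrt (1 - w.re ^ 2)) = 1 := by
      rw [Real.sin_arccos]; field_simp
    rw [hcoef, one_smul, Quaternion.re_add_im]

/-- The squared-geodesic-distance functional `k ↦ Σ_i arccos(Re(k u_i k⁻¹ q̄_i))²` is continuous on `SU(2)`. [folklore] -/
theorem continuous_sum_arccos_sq_conj {ι : Type*} [Fintype ι] (q u : ι → SU2) :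
    Continuous fun k : SU2 => ∑ i, Real.arccos ((su2Quat (k * u i * k⁻¹ * (q i)⁻¹)).re) ^ 2 := by
  refine continuous_finsetSum _ fun i _ => ?_
  refine (Real.continuous_arccos.comp (Quaternion.continuous_re.comp (continuous_su2Quat.comp ?_))).pow 2
  exact ((continuous_id.mul continuous_const).mul continuous_id.inv).mul continuous_const

/-- A minimiser of the squared-geodesic-distance functional over the compact group `SU(2)`. [folklore] -/
theorem exists_isMinOn_sum_arccos_sq_conj {ι : Type*} [Fintype ι] (q u : ι → SU2) :
    ∃ k₀ : SU2, ∀ k : SU2, ∑ i, Real.arccos ((su2Quat (k₀ * u i * k₀⁻¹ * (q i)⁻¹)).re) ^ 2 ≤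
      ∑ i, Real.arccos ((su2Quat (k * u i * k⁻¹ * (q i)⁻¹)).re) ^ 2 := by
  obtain ⟨k₀, -, hk₀⟩ := isCompact_univ.exists_isMinOn univ_nonempty (continuous_sum_arccos_sq_conj q u).continuousOn
  exact ⟨k₀, fun k => hk₀ (mem_univ k)⟩

/-- ★★ **The normal slice is hit (covering ∕ local surjectivity for the diagonal conjugation action of `SU(2)` on `SU(2)^I`).**
For every finite family `u` within `ℓ²`-geodesic distance `π` of the base point `q` (`Σ_i arccos(Re(u_i q̄_i))² < π²`) there are a
CONSTANT `k ∈ SU(2)` and imaginary quaternions `y_i` (the log-coordinates of `k u_i k⁻¹` in the LEFT chart at `q_i`) with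
`k u_i k⁻¹ = exp(y_i)·q_i`, `‖y_i‖ = arccos Re(k u_i k⁻¹ q̄_i)`, `Σ_i ‖y_i‖² ≤ Σ_i arccos(Re(u_i q̄_i))²`, and the SLICE EQUATION
`Σ_i (y_i − q̄_i y_i q_i) = 0` EXACTLY (orthogonality to the orbit tangent `η ↦ ((1 − Ad_{q_i})η)_i`).  Minimise the squared geodesic
distance over the compact group and apply the first variation (`sum_logSlice_eq_zero_of_isMinOn`).
[cite: Bredon1972, Ch. II §§4–5] [cite: Helgason2000, Ch. I §1 Thm 1.14] -/
theorem exists_conj_exp_slice {ι : Type*} [Fintype ι] (q u : ι → SU2)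
    (hπ : ∑ i, Real.arccos ((su2Quat (u i * (q i)⁻¹)).re) ^ 2 < Real.pi ^ 2) :
    ∃ (k : SU2) (y : ι → ℍ), (∀ i, (y i).re = 0) ∧
      (∀ i, exp (y i) * su2Quat (q i) = su2Quat (k * u i * k⁻¹)) ∧
      (∀ i, ‖y i‖ = Real.arccos ((su2Quat (k * u i * k⁻¹ * (q i)⁻¹)).re)) ∧
      (∑ i, ‖y i‖ ^ 2 ≤ ∑ i, Real.arccos ((su2Quat (u i * (q i)⁻¹)).re) ^ 2) ∧
      ∑ i, (y i - star (su2Quat (q i)) * y i * su2Quat (q i)) = 0 := by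
  obtain ⟨k₀, hk₀⟩ := exists_isMinOn_sum_arccos_sq_conj q u
  -- the minimum is below the value at the identity
  have hle : ∑ i, Real.arccos ((su2Quat (k₀ * u i * k₀⁻¹ * (q i)⁻¹)).re) ^ 2 ≤
      ∑ i, Real.arccos ((su2Quat (u i * (q i)⁻¹)).re) ^ 2 := by
    have h := hk₀ 1
    simpa using h
  -- no antipodes at the minimiser
  have hne : ∀ i, (su2Quat (k₀ * u i * k₀⁻¹ * (q i)⁻¹)).re ≠ -1 := by
    intro i hi
    have h1 : Real.arccos ((su2Quat (k₀ * u i * k₀⁻¹ * (q i)⁻¹)).re) ^ 2 ≤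
        ∑ j, Real.arccos ((su2Quat (k₀ * u j * k₀⁻¹ * (q j)⁻¹)).re) ^ 2 :=
      Finset.single_le_sum (f := fun j => Real.arccos ((su2Quat (k₀ * u j * k₀⁻¹ * (q j)⁻¹)).re) ^ 2)
        (fun j _ => sq_nonneg _) (Finset.mem_univ i)
    rw [hi, Real.arccos_neg_one] at h1
    linarith
  -- minimality re-centred at `v = k₀ u k₀⁻¹`
  have hmin : ∀ k : SU2, ∑ i, Real.arccos ((su2Quat ((k₀ * u i * k₀⁻¹) * (q i)⁻¹)).re) ^ 2 ≤
      ∑ i, Real.arccos ((su2Quat (k * (k₀ * u i * k₀⁻¹) * k⁻¹ * (q i)⁻¹)).re) ^ 2 := by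
    intro k
    have h := hk₀ (k * k₀)
    have e : ∀ i, k * k₀ * u i * (k * k₀)⁻¹ = k * (k₀ * u i * k₀⁻¹) * k⁻¹ := fun i => by
      rw [mul_inv_rev]; noncomm_ring
    simp only [e] at h
    exact h
  have hslice := sum_logSlice_eq_zero_of_isMinOn hne hmin
  refine ⟨k₀, fun i => (Real.arccos ((su2Quat (k₀ * u i * k₀⁻¹ * (q i)⁻¹)).re) /
      Real.sqrt (1 - (su2Quat (k₀ * u i * k₀⁻¹ * (q i)⁻¹)).re ^ 2)) • (su2Quat (k₀ * u i * k₀⁻¹ * (q i)⁻¹)).im,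
    fun i => by simp, fun i => ?_, fun i => norm_logQuat (norm_su2Quat _) (hne i), ?_, ?_⟩
  · rw [exp_logQuat (norm_su2Quat _) (hne i), ← su2Quat_mul, inv_mul_cancel_right]
  · calc ∑ i, ‖(Real.arccos ((su2Quat (k₀ * u i * k₀⁻¹ * (q i)⁻¹)).re) /
          Real.sqrt (1 - (su2Quat (k₀ * u i * k₀⁻¹ * (q i)⁻¹)).re ^ 2)) • (su2Quat (k₀ * u i * k₀⁻¹ * (q i)⁻¹)).im‖ ^ 2
        = ∑ i, Real.arccos ((su2Quat (k₀ * u i * k₀⁻¹ * (q i)⁻¹)).re) ^ 2 :=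
          Finset.sum_congr rfl fun i _ => by rw [norm_logQuat (norm_su2Quat _) (hne i)]
      _ ≤ _ := hle
  · rw [← hslice]
    refine Finset.sum_congr rfl fun i _ => ?_
    rw [quat_conj_smul, smul_sub]

end Summit.QuantumFields.YangMills.Theorems.QuantitativeLaplace
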